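import Literature.NumberTheory.DiophantineGeometry.GenEllValuationMultiplicity
import Literature.IUT.LogVolume.HeightDivisor
import Mathlib.NumberTheory.RamificationInertia.Valuation
import HarnessLib

/-!
# The meeting dictionary: `z = p(t)/q(t)` meets a cusp at a good place ⇒ `t` meets a root of `p·q·(p−q)`

Support lemma for the abc-iut cell's route item GenEllTwo (ledger `stmt-ABC-19679`; [GenEll] =
S. Mochizuki, *Arithmetic elliptic curves in general position*, Math. J. Okayama Univ. **52** (2010),
Thm. 2.1, proof pp. 12–13; cell work package W5, piece W5d-κT).  In the sharp-conductor step the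
conductor of the point `z = β(t(P))` of `ℙ¹ ∖ {0,1,∞}` (`β = p/q` a Belyi map unramified over `∞` with
`β(∞) ∉ {0,1,∞}`) is transported to the places where `t(P)` meets the fibre `B = β⁻¹({0,1,∞})` = the
roots of `p·q·(p − q)`.  This file proves the local statement behind that transport, at a GOOD place
(coefficients integral, the three leading coefficients units), in the valuation language of
`GenEllValuationMultiplicity.lean` (abc-iut-w5-d045):

* `valuation_div_eval_eq_one_of_one_lt` — if `1 < v t` then `v(p(t)/q(t)) = 1` and `v(p(t)/q(t) − 1) = 1`
  (`deg p = deg q = deg (p − q)`: all three values are `(v t)^n`);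
* **`exists_root_valuation_sub_lt_one_of_meets`** — if `z := p(t)/q(t)` meets `0`, `∞` or `1` at `v`
  (`v z < 1 ∨ 1 < v z ∨ v (z − 1) < 1`) then some root `b` of `p`, `q` or `p − q` has `v (t − b) < 1`;
* the number-field `ord` form `exists_root_ord_sub_pos_of_meets` (`0 < ord_w(t − b)`), which is the
  `hmeet`-producer for `FibreConductor.inv_finrank_mul_sum_logNorm_le_slope` (with `W` := the primes of
  the field over the conductor support of `z`), and the tower transfer `meets_of_under` (the conditions
  `v z < 1`, `1 < v z`, `v (z−1) < 1` pass from `w ∩ 𝓞_F` to `w`, Mathlib `valuation_liesOver`).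

Classical valuation bookkeeping ([GenEll] Prop. 1.7 (i) / the tree's `GenEllPullbackConductor` for the
`ℤ[X]`-model); no definitions; nothing here refers to the disputed parts of the abc-iut corpus.
[cite: MochizukiGenEll2010, Thm 2.1 proof pp.12-13]
-/

noncomputable section

namespace Literature.NumberTheory.DiophantineGeometry.FibreConductor

open _root_.Polynomial Literature.NumberTheory.DiophantineGeometry.GenEll

section Valuation

variable {K : Type*} [Field K] {Γ₀ : Type*} [LinearOrderedCommGroupWithZero Γ₀] (v : Valuation K Γ₀)

/-- Coefficients of a difference of `v`-integral polynomials are `v`-integral. [cite: MochizukiGenEll2010, Prop 1.7 (i) p.9] -/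
theorem valuation_coeff_sub_le_one {p q : K[X]} (hp : ∀ n, v (p.coeff n) ≤ 1)
    (hq : ∀ n, v (q.coeff n) ≤ 1) (n : ℕ) : v ((p - q).coeff n) ≤ 1 := by
  rw [coeff_sub]
  exact le_trans (v.map_sub _ _) (max_le (hp n) (hq n))

/-- At a place where `t` is NOT integral, a quotient of two integral polynomials of the same degree with
unit leading coefficients takes a UNIT value: `1 < v t ⇒ v (p(t)/q(t)) = 1`.
[cite: MochizukiGenEll2010, Prop 1.7 (i) p.9] -/
theorem valuation_div_eval_eq_one_of_one_lt {p q : K[X]} (hp : ∀ n, v (p.coeff n) ≤ 1)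
    (hq : ∀ n, v (q.coeff n) ≤ 1) (hlcp : v p.leadingCoeff = 1) (hlcq : v q.leadingCoeff = 1)
    (hdeg : p.natDegree = q.natDegree) {t : K} (ht : 1 < v t) :
    v (p.eval t / q.eval t) = 1 := by
  have hp' := valuation_eval_eq_pow_of_one_lt v hp hlcp ht
  have hq' := valuation_eval_eq_pow_of_one_lt v hq hlcq ht
  have ht0 : v t ≠ 0 := ne_of_gt (lt_trans zero_lt_one ht)
  have hqt : v (q.eval t) ≠ 0 := by rw [hq']; exact pow_ne_zero _ ht0
  rw [map_div₀, hp', hq', hdeg]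
  exact div_self (pow_ne_zero _ ht0)

/-- **The meeting dictionary (valuation form).**  Let `p`, `q` have `v`-integral coefficients, let the
leading coefficients of `p`, `q`, `p − q` be `v`-units, `deg p = deg q = deg (p − q)`, all three split in
`K`, and `q(t) ≠ 0`.  If `z := p(t)/q(t)` meets a cusp at `v` — `v z < 1` (meets `0`), `1 < v z` (meets
`∞`) or `v (z − 1) < 1` (meets `1`) — then `t` meets a point of the fibre: `v (t − b) < 1` for some root
`b` of `p`, `q` or `p − q`. [cite: MochizukiGenEll2010, Thm 2.1 proof pp.12-13] -/
theorem exists_root_valuation_sub_lt_one_of_meets {p q : K[X]}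
    (hp : ∀ n, v (p.coeff n) ≤ 1) (hq : ∀ n, v (q.coeff n) ≤ 1)
    (hlcp : v p.leadingCoeff = 1) (hlcq : v q.leadingCoeff = 1) (hlcpq : v (p - q).leadingCoeff = 1)
    (hdeg : p.natDegree = q.natDegree) (hdeg' : (p - q).natDegree = q.natDegree)
    (hsp : p.Splits) (hsq : q.Splits) (hspq : (p - q).Splits)
    {t : K} (hqt : q.eval t ≠ 0)
    (hmeet : v (p.eval t / q.eval t) < 1 ∨ 1 < v (p.eval t / q.eval t) ∨
      v (p.eval t / q.eval t - 1) < 1) :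
    ∃ b ∈ p.roots + q.roots + (p - q).roots, v (t - b) < 1 := by
  have hpq : ∀ n, v ((p - q).coeff n) ≤ 1 := valuation_coeff_sub_le_one v hp hq
  have hvq0 : v (q.eval t) ≠ 0 := (Valuation.ne_zero_iff v).mpr hqt
  -- `z - 1 = (p - q)(t) / q(t)`
  have hz1 : p.eval t / q.eval t - 1 = (p - q).eval t / q.eval t := by
    rw [eval_sub, sub_div, div_self hqt]
  rcases lt_or_ge 1 (v t) with ht | ht
  · -- `t` not integral: no meeting at all
    exfalso
    have h1 := valuation_div_eval_eq_one_of_one_lt v hp hq hlcp hlcq hdeg ht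
    have h2 : v (p.eval t / q.eval t - 1) = 1 := by
      rw [hz1]
      exact valuation_div_eval_eq_one_of_one_lt v hpq hq hlcpq hlcq hdeg' ht
    rcases hmeet with h | h | h
    · rw [h1] at h; exact lt_irrefl _ h
    · rw [h1] at h; exact lt_irrefl _ h
    · rw [h2] at h; exact lt_irrefl _ h
  · -- `t` integral: the three cases
    have hqle : v (q.eval t) ≤ 1 := valuation_eval_le_one v hq ht
    have hple : v (p.eval t) ≤ 1 := valuation_eval_le_one v hp ht
    have hroots : ∀ (f : K[X]), (∀ n, v (f.coeff n) ≤ 1) → v f.leadingCoeff = 1 →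
        ∀ a ∈ f.roots, v a ≤ 1 := by
      intro f hf hlc a ha
      have hf0 : f ≠ 0 := by rintro rfl; simp at hlc
      exact valuation_le_one_of_isRoot v hf hlc ((mem_roots hf0).mp ha)
    rcases hmeet with h | h | h
    · -- meets `0`: `v p(t) < v q(t) ≤ 1`
      have hlt : v (p.eval t) < 1 := by
        rw [map_div₀, div_lt_one₀ (zero_lt_iff.mpr hvq0)] at h
        exact lt_of_lt_of_le h hqle
      obtain ⟨b, hb, hvb⟩ := exists_root_valuation_sub_lt_one v hsp hlcp (hroots p hp hlcp) ht hlt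
      exact ⟨b, Multiset.mem_add.mpr (Or.inl (Multiset.mem_add.mpr (Or.inl hb))), hvb⟩
    · -- meets `∞`: `v q(t) < v p(t) ≤ 1`
      have hlt : v (q.eval t) < 1 := by
        rw [map_div₀, one_lt_div₀ (zero_lt_iff.mpr hvq0)] at h
        exact lt_of_lt_of_le h hple
      obtain ⟨b, hb, hvb⟩ := exists_root_valuation_sub_lt_one v hsq hlcq (hroots q hq hlcq) ht hlt
      exact ⟨b, Multiset.mem_add.mpr (Or.inl (Multiset.mem_add.mpr (Or.inr hb))), hvb⟩
    · -- meets `1`: `v (p-q)(t) < v q(t) ≤ 1`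
      rw [hz1] at h
      have hlt : v ((p - q).eval t) < 1 := by
        rw [map_div₀, div_lt_one₀ (zero_lt_iff.mpr hvq0)] at h
        exact lt_of_lt_of_le h hqle
      obtain ⟨b, hb, hvb⟩ :=
        exists_root_valuation_sub_lt_one v hspq hlcpq (hroots (p - q) hpq hlcpq) ht hlt
      exact ⟨b, Multiset.mem_add.mpr (Or.inr hb), hvb⟩

end Valuation

/-! ## Number-field `ord` form -/

section NumberField

open NumberField IsDedekindDomain Literature.IUT.LogVolume

variable {L : Type*} [Field L] [NumberField L]

/-- **The meeting dictionary (`ord` form at a finite place of a number field).**  Same hypotheses at the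
place `w` (read through `w.valuation L`); if `z = p(t)/q(t)` meets a cusp at `w`
(`0 < ord_w z`, `ord_w z < 0` or `0 < ord_w (z − 1)`, with `z ≠ 0, 1`) and `t` is not itself in the fibre,
then `0 < ord_w (t − b)` for some root `b` of `p`, `q` or `p − q` — the `hmeet` input of
`FibreConductor.inv_finrank_mul_sum_logNorm_le_slope` at `w`. [cite: MochizukiGenEll2010, Thm 2.1 proof pp.12-13] -/
theorem exists_root_ord_sub_pos_of_meets (w : HeightOneSpectrum (𝓞 L)) {p q : L[X]}
    (hp : ∀ n, w.valuation L (p.coeff n) ≤ 1) (hq : ∀ n, w.valuation L (q.coeff n) ≤ 1)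
    (hlcp : w.valuation L p.leadingCoeff = 1) (hlcq : w.valuation L q.leadingCoeff = 1)
    (hlcpq : w.valuation L (p - q).leadingCoeff = 1)
    (hdeg : p.natDegree = q.natDegree) (hdeg' : (p - q).natDegree = q.natDegree)
    (hsp : p.Splits) (hsq : q.Splits) (hspq : (p - q).Splits)
    {t : L} (hqt : q.eval t ≠ 0) (hz0 : p.eval t / q.eval t ≠ 0) (hz1 : p.eval t / q.eval t - 1 ≠ 0)
    (htB : ∀ b ∈ p.roots + q.roots + (p - q).roots, t ≠ b)
    (hmeet : 0 < ord L w (p.eval t / q.eval t) ∨ ord L w (p.eval t / q.eval t) < 0 ∨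
      0 < ord L w (p.eval t / q.eval t - 1)) :
    ∃ b ∈ p.roots + q.roots + (p - q).roots, 0 < ord L w (t - b) := by
  have hmeet' : w.valuation L (p.eval t / q.eval t) < 1 ∨ 1 < w.valuation L (p.eval t / q.eval t) ∨
      w.valuation L (p.eval t / q.eval t - 1) < 1 := by
    rcases hmeet with h | h | h
    · exact Or.inl ((ord_pos_iff_valuation_lt_one L w hz0).mp h)
    · exact Or.inr (Or.inl ((ord_neg_iff_one_lt_valuation L w hz0).mp h))
    · exact Or.inr (Or.inr ((ord_pos_iff_valuation_lt_one L w hz1).mp h))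
  obtain ⟨b, hb, hvb⟩ := exists_root_valuation_sub_lt_one_of_meets (w.valuation L) hp hq hlcp hlcq
    hlcpq hdeg hdeg' hsp hsq hspq hqt hmeet'
  exact ⟨b, hb, (ord_pos_iff_valuation_lt_one L w (sub_ne_zero.mpr (htB b hb))).mpr hvb⟩


/-- **Tower transfer of "meets a cusp".**  For a map of number fields `ι : F → L`, a finite place `w` of
`L` and `v := w ∩ 𝓞_F`: if `z ∈ F` meets `0`, `∞` or `1` at `v` then `ι z` meets the same cusp at `w`
(`v(z)^{e(w|v)} = w(ι z)`, Mathlib `valuation_liesOver`; the pattern of the tree's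
`GenEll.NFPoint.mem_condSupportDiv_pullbackCusps`).  This moves the conductor support of the point
`z` of `ℙ¹` (the tree's `NFPoint.condSupport`, read on `F = ℚ(z)`) up to the field of the fibre point.
[cite: MochizukiGenEll2010, Prop 1.7 (i) p.9] -/
theorem meets_of_under {F : Type*} [Field F] [NumberField F] (ι : F →+* L)
    (w : HeightOneSpectrum (𝓞 L)) (z : F)
    (hz : letI : Algebra F L := ι.toAlgebra
      (w.under (𝓞 F)).valuation F z < 1 ∨ 1 < (w.under (𝓞 F)).valuation F z ∨
        (w.under (𝓞 F)).valuation F (z - 1) < 1) :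
    w.valuation L (ι z) < 1 ∨ 1 < w.valuation L (ι z) ∨ w.valuation L (ι z - 1) < 1 := by
  letI : Algebra F L := ι.toAlgebra
  set v : HeightOneSpectrum (𝓞 F) := w.under (𝓞 F) with hv
  haveI : w.asIdeal.LiesOver v.asIdeal := ⟨rfl⟩
  have he : v.asIdeal.ramificationIdx' w.asIdeal ≠ 0 :=
    Ideal.IsDedekindDomain.ramificationIdx'_ne_zero_of_liesOver w.asIdeal v.ne_bot
  have hlies : ∀ y : F, v.valuation F y ^ v.asIdeal.ramificationIdx' w.asIdeal =
      w.valuation L (ι y) := fun y => HeightOneSpectrum.valuation_liesOver L v w y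
  have hlt : ∀ y : F, v.valuation F y < 1 → w.valuation L (ι y) < 1 := fun y hy => by
    rw [← hlies y]; exact pow_lt_one₀ zero_le hy he
  have hgt : ∀ y : F, 1 < v.valuation F y → 1 < w.valuation L (ι y) := fun y hy => by
    rw [← hlies y]; exact one_lt_pow₀ hy he
  rcases hz with h | h | h
  · exact Or.inl (hlt z h)
  · exact Or.inr (Or.inl (hgt z h))
  · right; right
    have := hlt (z - 1) h
    rwa [map_sub, map_one] at this

end NumberField

end Literature.NumberTheory.DiophantineGeometry.FibreConductor
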